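import Literature.NumberTheory.Sieve.ParityWave0
import HarnessLib

/-!
# parity.S29 — Polymath 8a, Definition 2.1 and Lemma 2.10 (0)–(iii): multiple dense divisibility

Topic `Literature/NumberTheory/Sieve`; a sibling file of `ParityWave0.lean` serving the named fact
`Literature.NumberTheory.Sieve.mpz_of_lt` (**parity.S29**: `MPZ[ϖ, δ]` whenever `600ϖ + 180δ < 7` —
D. H. J. Polymath, *New equidistribution estimates of Zhang type*, Algebra Number Theory 8 (2014)
2067–2199 = arXiv:1402.0811, Theorem 2.4(i)).  What Polymath 8a proves is the stronger claim
`MPZ^{(4)}[ϖ, δ]` (Claim 2.3) about *`4`-tuply `x^δ`-densely divisible* moduli; the vendored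
smooth-moduli statement `MPZ` follows from it because "any `y`-smooth number is `i`-tuply `y`-densely
divisible" (Lemma 2.10(iii), invoked in the display after Theorem 2.4).  This file vendors the notion
and PROVES that bridge:

* `Literature.NumberTheory.Sieve.DenselyDivisible y i n` — Definition 2.1 ("`i`-tuply `y`-densely
  divisible"), by well-founded recursion on `i`, with its defining clauses
  (`denselyDivisible_zero`, `denselyDivisible_succ_iff`);
* Lemma 2.10 (0): monotonicity in `y` (`DenselyDivisible.mono`) and in `i`
  (`DenselyDivisible.of_succ`, `DenselyDivisible.anti`);
* the reduction used throughout the printed proof ("it suffices to consider parameters `R` with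
  `1 ≤ R ≤ n`", `DenselyDivisible.succ_of_le_self`), and `1` is densely divisible of every order;
* Lemma 2.10 (iii): a `y`-smooth number is `i`-tuply `y`-densely divisible for every `i`
  (`DenselyDivisible.of_smooth`; in Mathlib terms `DenselyDivisible.of_mem_smoothNumbers`), through the
  printed device "let `r` be the largest divisor of `n` which is `≤ R`"
  (`exists_divisor_mem_Icc_of_smooth`);
* Lemma 2.10 (ii): the least common multiple of two `y`-densely divisible numbers is `y`-densely
  divisible (`DenselyDivisible.lcm`, with the window-only form `denselyDivisible_one_iff` of
  `1`-tuple dense divisibility);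
* Lemma 2.10 (i): a divisor `m` of an `i`-tuply `y`-densely divisible `n = m m₁` is `i`-tuply
  `y m₁`-densely divisible (`DenselyDivisible.of_mul_right`, the printed gcd argument), and a multiple
  `an` is `i`-tuply `ya`-densely divisible (`DenselyDivisible.mul_left`, "left to the reader" in
  print).

Part (iv) of Lemma 2.10 (the criterion `∏_{p ∣ n, p ≤ y} p ≥ z^i/y` for `z`-smooth squarefree `n`),
which serves the dense-divisibility bookkeeping of the Type I/II estimates (§5), is not vendored here.
Nothing in this file discharges `mpz_of_lt`.

## References

* D. H. J. Polymath, *New equidistribution estimates of Zhang type*, Algebra Number Theory 8 (2014),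
  2067–2199, arXiv:1402.0811: Definition 2.1, Lemma 2.10 and its proof (§2.3), the display after
  Theorem 2.4. [cite: Polymath8a2014]
-/

open Finset

namespace Literature.NumberTheory.Sieve

/-- **Multiple dense divisibility** (Polymath 8a, Definition 2.1): "Let `y ≥ 1`. (i) Every natural
number `n` is `0`-tuply `y`-densely divisible. (ii) If `i ≥ 1` and `n` is a natural number, we say
that `n` is `i`-tuply `y`-densely divisible if, whenever `j, k ≥ 0` are natural numbers with
`j + k = i − 1`, and `1 ≤ R ≤ yn`, one can find a factorisation `n = qr`, with `y^{-1} R ≤ r ≤ R`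
such that `q` is `j`-tuply `y`-densely divisible and `r` is `k`-tuply `y`-densely divisible."
`DenselyDivisible y i n` is "`n` is `i`-tuply `y`-densely divisible" (`R` real; defined by
well-founded recursion on `i`). [cite: Polymath8a2014, Definition 2.1] -/
def DenselyDivisible (y : ℝ) : ℕ → ℕ → Prop
  | 0, _ => True
  | i + 1, n => ∀ j k : ℕ, j + k = i → ∀ R : ℝ, 1 ≤ R → R ≤ y * n →
      ∃ q r : ℕ, n = q * r ∧ R / y ≤ r ∧ (r : ℝ) ≤ R ∧
        DenselyDivisible y j q ∧ DenselyDivisible y k r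
termination_by i _ => i
decreasing_by all_goals omega

/-- Definition 2.1(i): every `n` is `0`-tuply `y`-densely divisible. [cite: Polymath8a2014, Definition 2.1] -/
@[simp] theorem denselyDivisible_zero (y : ℝ) (n : ℕ) : DenselyDivisible y 0 n := by
  simp [DenselyDivisible]

/-- Definition 2.1(ii), the recursive clause. [cite: Polymath8a2014, Definition 2.1] -/
theorem denselyDivisible_succ_iff (y : ℝ) (i n : ℕ) :
    DenselyDivisible y (i + 1) n ↔ ∀ j k : ℕ, j + k = i → ∀ R : ℝ, 1 ≤ R → R ≤ y * n →
      ∃ q r : ℕ, n = q * r ∧ R / y ≤ r ∧ (r : ℝ) ≤ R ∧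
        DenselyDivisible y j q ∧ DenselyDivisible y k r := by
  rw [DenselyDivisible]

/-- `1` is `i`-tuply `y`-densely divisible for every `i` (the only parameters are `1 ≤ R ≤ y`, served
by `1 = 1 · 1`). [cite: Polymath8a2014, Definition 2.1] -/
theorem denselyDivisible_one (y : ℝ) (i : ℕ) : DenselyDivisible y i 1 := by
  induction i using Nat.strong_induction_on with
  | _ i ih =>
    cases i with
    | zero => exact denselyDivisible_zero y 1
    | succ i =>
      rw [denselyDivisible_succ_iff]
      intro j k hjk R hR1 hRy
      rw [Nat.cast_one, mul_one] at hRy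
      have hy : 0 < y := by linarith
      refine ⟨1, 1, rfl, ?_, by exact_mod_cast hR1, ih j (by omega), ih k (by omega)⟩
      rw [Nat.cast_one, div_le_one hy]
      exact hRy

/-! ### Lemma 2.10 (0): monotonicity -/

/-- **Lemma 2.10 (0), second clause, one step**: an `(i+1)`-tuply `y`-densely divisible number is
`i`-tuply `y`-densely divisible (ask for a factorisation with `j + 1` in place of `j` and forget one
order of divisibility of `q`, inductively). [cite: Polymath8a2014, Lemma 2.10 (0)] -/
theorem DenselyDivisible.of_succ {y : ℝ} : ∀ {i n : ℕ}, DenselyDivisible y (i + 1) n →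
    DenselyDivisible y i n := by
  intro i
  induction i using Nat.strong_induction_on with
  | _ i ih =>
    intro n h
    cases i with
    | zero => exact denselyDivisible_zero y n
    | succ i =>
      rw [denselyDivisible_succ_iff] at h ⊢
      intro j k hjk R hR1 hR2
      obtain ⟨q, r, hn, hr1, hr2, hq, hr⟩ := h (j + 1) k (by omega) R hR1 hR2
      exact ⟨q, r, hn, hr1, hr2, ih j (by omega) hq, hr⟩

/-- **Lemma 2.10 (0), second clause**: "if `0 ≤ j ≤ i`, then `n` is `j`-tuply `y`-densely
divisible" whenever it is `i`-tuply so. [cite: Polymath8a2014, Lemma 2.10 (0)] -/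
theorem DenselyDivisible.anti {y : ℝ} {i j n : ℕ} (h : DenselyDivisible y i n) (hji : j ≤ i) :
    DenselyDivisible y j n := by
  induction i, hji using Nat.le_induction with
  | base => exact h
  | succ i _ ih => exact ih h.of_succ

/-- **Lemma 2.10 (0), first clause**: for `1 ≤ y ≤ y₁`, an `i`-tuply `y`-densely divisible number
is `i`-tuply `y₁`-densely divisible (a window `[R/y, R]` lies inside `[R/y₁, R]`; the parameters
`yn < R ≤ y₁ n` are served by `n = 1 · n`, `n` itself being densely divisible of lower order by the
second clause). [cite: Polymath8a2014, Lemma 2.10 (0)] -/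
theorem DenselyDivisible.mono {y y₁ : ℝ} (hy : 1 ≤ y) (hyy : y ≤ y₁) :
    ∀ {i n : ℕ}, DenselyDivisible y i n → DenselyDivisible y₁ i n := by
  intro i
  induction i using Nat.strong_induction_on with
  | _ i ih =>
    intro n h
    cases i with
    | zero => exact denselyDivisible_zero y₁ n
    | succ i =>
      have h' := h
      rw [denselyDivisible_succ_iff] at h ⊢
      intro j k hjk R hR1 hR2
      have hy0 : 0 < y := by linarith
      rcases le_or_gt R (y * n) with hRy | hRy
      · obtain ⟨q, r, hn, hr1, hr2, hq, hr⟩ := h j k hjk R hR1 hRy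
        exact ⟨q, r, hn, (div_le_div_of_nonneg_left (by linarith) hy0 hyy).trans hr1, hr2,
          ih j (by omega) hq, ih k (by omega) hr⟩
      · -- `yn < R ≤ y₁ n`: the factorisation `n = 1 · n`
        have hn0 : (0 : ℝ) ≤ n := Nat.cast_nonneg n
        refine ⟨1, n, (one_mul n).symm, ?_, ?_, denselyDivisible_one y₁ j, ?_⟩
        · rw [div_le_iff₀ (by linarith)]
          calc R ≤ y₁ * n := hR2
            _ = n * y₁ := mul_comm _ _
        · calc (n : ℝ) = 1 * n := (one_mul _).symm
            _ ≤ y * n := mul_le_mul_of_nonneg_right hy hn0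
            _ ≤ R := hRy.le
        · exact ih k (by omega) (h'.anti (by omega))

/-! ### The reduction to `1 ≤ R ≤ n` -/

/-- **The standing reduction of the printed proof of Lemma 2.10**: "in checking that an integer `n`
is `(i, y)`-d.d., it suffices to consider parameters `R` with `1 ≤ R ≤ n` … indeed, if `n < R ≤ yn`,
the factorization `n = qr` with `r = n` and `q = 1` satisfies the condition `y^{-1} R ≤ r ≤ R`, and
`r = n` is `(j, y)`-d.d. (resp. `q = 1` is `(k, y)`-d.d.) whenever `j + k = i − 1`" — granted, as in
every printed use, that `n` is already known to be densely divisible of all lower orders.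
[cite: Polymath8a2014, proof of Lemma 2.10 (preliminary remark)] -/
theorem DenselyDivisible.succ_of_le_self {y : ℝ} (hy : 1 ≤ y) {i n : ℕ}
    (hlow : ∀ j ≤ i, DenselyDivisible y j n)
    (hR : ∀ j k : ℕ, j + k = i → ∀ R : ℝ, 1 ≤ R → R ≤ n →
      ∃ q r : ℕ, n = q * r ∧ R / y ≤ r ∧ (r : ℝ) ≤ R ∧
        DenselyDivisible y j q ∧ DenselyDivisible y k r) :
    DenselyDivisible y (i + 1) n := by
  rw [denselyDivisible_succ_iff]
  intro j k hjk R hR1 hR2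
  rcases le_or_gt R n with hRn | hRn
  · exact hR j k hjk R hR1 hRn
  · refine ⟨1, n, (one_mul n).symm, ?_, hRn.le, denselyDivisible_one y j, hlow k (by omega)⟩
    rw [div_le_iff₀ (by linarith)]
    calc R ≤ y * n := hR2
      _ = n * y := mul_comm _ _

/-! ### Lemma 2.10 (iii): smooth numbers are densely divisible -/

/-- **"Let `r` be the largest divisor of `n` which is `≤ R`"** (proof of Lemma 2.10 (iii)): if `y ≥ 1`,
every prime factor of `n ≥ 1` is `≤ y` and `1 ≤ R ≤ n`, then `n` has a divisor `r` with
`R/y ≤ r ≤ R` — the largest divisor `r ≤ R` works, for either `r = n`, or `n/r > 1` has a prime factor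
`p ≤ y` and `rp` is a larger divisor, whence `rp > R`. [cite: Polymath8a2014, proof of Lemma 2.10 (iii)] -/
theorem exists_divisor_mem_Icc_of_smooth {y : ℝ} (hy : 1 ≤ y) {n : ℕ} (hn : n ≠ 0)
    (hs : ∀ p : ℕ, p.Prime → p ∣ n → (p : ℝ) ≤ y) {R : ℝ} (hR1 : 1 ≤ R) (hRn : R ≤ n) :
    ∃ r : ℕ, r ∣ n ∧ R / y ≤ r ∧ (r : ℝ) ≤ R := by
  classical
  set D : Finset ℕ := n.divisors.filter fun d => (d : ℝ) ≤ R with hD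
  have h1D : 1 ∈ D := Finset.mem_filter.mpr ⟨Nat.one_mem_divisors.mpr hn, by exact_mod_cast hR1⟩
  have hDne : D.Nonempty := ⟨1, h1D⟩
  set r : ℕ := D.max' hDne with hr
  have hrD : r ∈ D := Finset.max'_mem D hDne
  obtain ⟨hrdiv, hrR⟩ := Finset.mem_filter.mp hrD
  have hrn : r ∣ n := Nat.dvd_of_mem_divisors hrdiv
  have hr0 : 0 < r := Nat.pos_of_mem_divisors hrdiv
  refine ⟨r, hrn, ?_, hrR⟩
  have hy0 : 0 < y := by linarith
  obtain ⟨q, hq⟩ := hrn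
  rcases eq_or_ne q 1 with hq1 | hq1
  · -- `r = n`
    rw [hq1, mul_one] at hq
    rw [← hq]
    calc R / y ≤ R := div_le_self (by linarith) hy
      _ ≤ n := hRn
  · -- `n / r > 1` has a prime factor `p ≤ y`, and `rp ∣ n` exceeds `R`
    set p : ℕ := q.minFac with hp
    have hpp : p.Prime := Nat.minFac_prime hq1
    have hpq : p ∣ q := Nat.minFac_dvd q
    have hpn : p ∣ n := hpq.trans (Dvd.intro_left r hq.symm)
    have hpy : (p : ℝ) ≤ y := hs p hpp hpn
    have hrp : r * p ∣ n := by rw [hq]; exact mul_dvd_mul_left r hpq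
    have hnot : ¬ ((r * p : ℕ) : ℝ) ≤ R := by
      intro hle
      have hmem : r * p ∈ D := Finset.mem_filter.mpr ⟨Nat.mem_divisors.mpr ⟨hrp, hn⟩, hle⟩
      have hle' : r * p ≤ r := Finset.le_max' D _ hmem
      have h2 : 2 ≤ p := hpp.two_le
      nlinarith
    push Not at hnot
    rw [div_le_iff₀ hy0]
    have : ((r * p : ℕ) : ℝ) ≤ r * y := by
      push_cast; exact mul_le_mul_of_nonneg_left hpy (Nat.cast_nonneg r)
    linarith

/-- **Lemma 2.10 (iii)**: "Any `y`-smooth number is `i`-tuply `y`-densely divisible" (`y ≥ 1`, `n ≥ 1`,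
`y`-smooth meaning every prime factor is `≤ y`).  Printed proof: induction on `i`; for `1 ≤ R ≤ n`
take the largest divisor `r ≤ R` (`exists_divisor_mem_Icc_of_smooth`) and `q = n/r`, both `y`-smooth
and hence densely divisible of the lower orders; parameters `n < R ≤ yn` by the standing reduction
(`DenselyDivisible.succ_of_le_self`). [cite: Polymath8a2014, Lemma 2.10 (iii)] -/
theorem DenselyDivisible.of_smooth {y : ℝ} (hy : 1 ≤ y) :
    ∀ (i : ℕ) {n : ℕ}, n ≠ 0 → (∀ p : ℕ, p.Prime → p ∣ n → (p : ℝ) ≤ y) →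
      DenselyDivisible y i n := by
  intro i
  induction i using Nat.strong_induction_on with
  | _ i ih =>
    intro n hn hs
    cases i with
    | zero => exact denselyDivisible_zero y n
    | succ i =>
      refine DenselyDivisible.succ_of_le_self hy (fun j hj => ih j (by omega) hn hs) ?_
      intro j k hjk R hR1 hRn
      obtain ⟨r, hrn, hr1, hr2⟩ := exists_divisor_mem_Icc_of_smooth hy hn hs hR1 hRn
      have hnqr : n = n / r * r := (Nat.div_mul_cancel hrn).symm
      have hq0 : n / r ≠ 0 := fun h => hn (by rw [hnqr, h, zero_mul])
      have hr0 : r ≠ 0 := fun h => hn (by rw [hnqr, h, mul_zero])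
      have hqs : ∀ p : ℕ, p.Prime → p ∣ n / r → (p : ℝ) ≤ y :=
        fun p hp hpq => hs p hp (hpq.trans (Nat.div_dvd_of_dvd hrn))
      have hrs : ∀ p : ℕ, p.Prime → p ∣ r → (p : ℝ) ≤ y :=
        fun p hp hpr => hs p hp (hpr.trans hrn)
      exact ⟨n / r, r, hnqr, hr1, hr2, ih j (by omega) hq0 hqs, ih k (by omega) hr0 hrs⟩

/-- Lemma 2.10 (iii) in Mathlib terms: an `x^δ`-smooth modulus in the sense of the vendored `MPZ`
(`q ∈ Nat.smoothNumbers (⌊y⌋₊ + 1)`, i.e. all prime factors `≤ ⌊y⌋`) is `i`-tuply `y`-densely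
divisible for every `i` (`y ≥ 1`) — the passage from Polymath's `MPZ^{(i)}[ϖ, δ]` (Claim 2.3, moduli
in `D^{(i)}(x^δ)`) to the smooth-moduli statement `MPZ ϖ δ` (display after Theorem 2.4).
[cite: Polymath8a2014, Lemma 2.10 (iii) and the display after Theorem 2.4] -/
theorem DenselyDivisible.of_mem_smoothNumbers {y : ℝ} (hy : 1 ≤ y) {n : ℕ}
    (h : n ∈ Nat.smoothNumbers (⌊y⌋₊ + 1)) (i : ℕ) : DenselyDivisible y i n := by
  refine DenselyDivisible.of_smooth hy i (Nat.ne_zero_of_mem_smoothNumbers h) fun p hp hpn => ?_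
  have hp' : p ≤ ⌊y⌋₊ := Nat.lt_succ_iff.mp ((Nat.mem_smoothNumbers'.mp h) p hp hpn)
  calc (p : ℝ) ≤ ⌊y⌋₊ := by exact_mod_cast hp'
    _ ≤ y := Nat.floor_le (by linarith)

/-! ### Lemma 2.10 (ii): least common multiples -/

/-- For `1`-tuply dense divisibility only the window matters: `n` is `y`-densely divisible iff for
every `1 ≤ R ≤ yn` it has a factorisation `n = qr` with `R/y ≤ r ≤ R`. [cite: Polymath8a2014, Definition 2.1] -/
theorem denselyDivisible_one_iff (y : ℝ) (n : ℕ) :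
    DenselyDivisible y 1 n ↔ ∀ R : ℝ, 1 ≤ R → R ≤ y * n →
      ∃ q r : ℕ, n = q * r ∧ R / y ≤ r ∧ (r : ℝ) ≤ R := by
  rw [show (1 : ℕ) = 0 + 1 from rfl, denselyDivisible_succ_iff]
  constructor
  · intro h R hR1 hR2
    obtain ⟨q, r, hn, hr1, hr2, -, -⟩ := h 0 0 rfl R hR1 hR2
    exact ⟨q, r, hn, hr1, hr2⟩
  · intro h j k hjk R hR1 hR2
    obtain ⟨q, r, hn, hr1, hr2⟩ := h R hR1 hR2
    obtain ⟨rfl, rfl⟩ : j = 0 ∧ k = 0 := by omega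
    exact ⟨q, r, hn, hr1, hr2, denselyDivisible_zero y q, denselyDivisible_zero y r⟩

/-- **Lemma 2.10 (ii)**: "If `m, n` are `y`-densely divisible, then `[m, n]` is also `y`-densely
divisible" (`y ≥ 1`, `m, n ≥ 1`).  Printed proof: assume `m ≤ n` and put `a = [m, n]/n` (so
`a ≤ m ≤ n`); for `R ≤ n` a factorisation `n = qr` with `R/y ≤ r ≤ R` gives `[m, n] = (aq) r`; for
`n < R ≤ [m, n]` one has `1 ≤ R/a ≤ n`, and `n = qr` with `R/(ay) ≤ r ≤ R/a` gives
`[m, n] = q (ar)`. [cite: Polymath8a2014, Lemma 2.10 (ii)] -/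
theorem DenselyDivisible.lcm {y : ℝ} (hy : 1 ≤ y) {m n : ℕ} (hm0 : m ≠ 0) (hn0 : n ≠ 0)
    (hm : DenselyDivisible y 1 m) (hn : DenselyDivisible y 1 n) :
    DenselyDivisible y 1 (Nat.lcm m n) := by
  -- reduce to `m ≤ n`
  wlog hmn : m ≤ n generalizing m n
  · rw [Nat.lcm_comm]; exact this hn0 hm0 hn hm (le_of_not_ge hmn)
  have hy0 : 0 < y := by linarith
  set L : ℕ := Nat.lcm m n with hL
  have hL0 : L ≠ 0 := Nat.lcm_ne_zero hm0 hn0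
  have hnL : n ∣ L := Nat.dvd_lcm_right m n
  obtain ⟨a, ha⟩ := hnL
  have ha0 : a ≠ 0 := fun h => hL0 (by rw [ha, h, mul_zero])
  have haL : a * n = L := by rw [ha, mul_comm]
  -- `a ≤ m ≤ n`
  have ham : a ≤ m := by
    have h1 : L ∣ m * n := Nat.lcm_dvd_mul m n
    have h2 : a * n ≤ m * n := by rw [haL]; exact Nat.le_of_dvd (Nat.pos_of_ne_zero (mul_ne_zero hm0 hn0)) h1
    exact Nat.le_of_mul_le_mul_right h2 (Nat.pos_of_ne_zero hn0)
  have han : (a : ℝ) ≤ n := by exact_mod_cast ham.trans hmn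
  have ha1 : (1 : ℝ) ≤ a := by exact_mod_cast Nat.one_le_iff_ne_zero.mpr ha0
  have hapos : (0 : ℝ) < a := by linarith
  rw [denselyDivisible_one_iff] at hn
  -- it suffices to treat `R ≤ L`
  refine DenselyDivisible.succ_of_le_self (i := 0) hy (fun j hj => ?_) ?_
  · obtain rfl : j = 0 := by omega
    exact denselyDivisible_zero y L
  intro j k hjk R hR1 hRL
  obtain ⟨rfl, rfl⟩ : j = 0 ∧ k = 0 := by omega
  simp only [denselyDivisible_zero, and_true]
  rcases le_or_gt R n with hRn | hRn
  · -- `R ≤ n`: `L = (a q) r`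
    obtain ⟨q, r, hnqr, hr1, hr2⟩ := hn R hR1 (hRn.trans (by
      calc (n : ℝ) = 1 * n := (one_mul _).symm
        _ ≤ y * n := mul_le_mul_of_nonneg_right hy (Nat.cast_nonneg n)))
    refine ⟨a * q, r, ?_, hr1, hr2⟩
    rw [← haL, hnqr]; ring
  · -- `n < R ≤ L`: `L = q (a r)` with `n = q r`, `R/(ay) ≤ r ≤ R/a`
    have hR' : 1 ≤ R / a := by
      rw [le_div_iff₀ hapos, one_mul]; linarith
    have hR'' : R / a ≤ y * n := by
      rw [div_le_iff₀ hapos]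
      calc R ≤ L := hRL
        _ = a * n := by rw [← haL]; push_cast; ring
        _ = 1 * (n * a) := by ring
        _ ≤ y * (n * a) := mul_le_mul_of_nonneg_right hy (by positivity)
        _ = y * n * a := by ring
    obtain ⟨q, r, hnqr, hr1, hr2⟩ := hn (R / a) hR' hR''
    refine ⟨q, a * r, ?_, ?_, ?_⟩
    · rw [← haL, hnqr]; ring
    · rw [div_le_iff₀ hy0, div_le_iff₀ hapos] at hr1
      rw [div_le_iff₀ hy0]
      push_cast
      calc R ≤ r * y * a := hr1
        _ = a * r * y := by ring
    · rw [le_div_iff₀ hapos] at hr2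
      push_cast
      calc (a : ℝ) * r = r * a := mul_comm _ _
        _ ≤ R := hr2

/-! ### Lemma 2.10 (i): divisors and multiples -/

/-- **Lemma 2.10 (i), first clause**: "If `n` is `i`-tuply `y`-densely divisible, and `m` is a
divisor of `n`, then `m` is `i`-tuply `y(n/m)`-densely divisible" — here `n = m m₁`, `y ≥ 1`,
`m, m₁ ≥ 1`.  Printed proof (induction on `i`): for `1 ≤ R ≤ m` factor `n = qr` with `R/y ≤ r ≤ R`;
with `n₁ = (r, m₁)`, `m₁ = n₁ n₁'`, the factorisation `m = q₁ r₁`, `q₁ = q/n₁'`, `r₁ = r/n₁`, has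
`R/(y m₁) ≤ r/m₁ ≤ r₁ ≤ R`, and `r₁ ∣ r`, `q₁ ∣ q` are densely divisible of the right orders and
parameter `y n₁, y n₁' ≤ y m₁` by induction and part (0). [cite: Polymath8a2014, Lemma 2.10 (i)] -/
theorem DenselyDivisible.of_mul_right {y : ℝ} (hy : 1 ≤ y) :
    ∀ (i : ℕ) {m m₁ : ℕ}, m ≠ 0 → m₁ ≠ 0 → DenselyDivisible y i (m * m₁) →
      DenselyDivisible (y * m₁) i m := by
  intro i
  induction i using Nat.strong_induction_on with
  | _ i ih =>
    intro m m₁ hm0 hm₁0 h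
    cases i with
    | zero => exact denselyDivisible_zero _ m
    | succ i =>
      have hy0 : 0 < y := by linarith
      have hm₁1 : (1 : ℝ) ≤ m₁ := by exact_mod_cast Nat.one_le_iff_ne_zero.mpr hm₁0
      have hym₁ : 1 ≤ y * m₁ := one_le_mul_of_one_le_of_one_le hy hm₁1
      refine DenselyDivisible.succ_of_le_self hym₁
        (fun j hj => ih j (by omega) hm0 hm₁0 (h.anti (by omega))) ?_
      intro j k hjk R hR1 hRm
      have h' := (denselyDivisible_succ_iff y i (m * m₁)).mp h
      have hRn : R ≤ y * (m * m₁ : ℕ) := by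
        calc R ≤ m := hRm
          _ ≤ 1 * ((m : ℝ) * 1) := by ring_nf; exact le_rfl
          _ ≤ y * ((m : ℝ) * m₁) :=
              mul_le_mul hy (mul_le_mul_of_nonneg_left hm₁1 (Nat.cast_nonneg m)) (by positivity)
                hy0.le
          _ = y * (m * m₁ : ℕ) := by push_cast; ring
      obtain ⟨q, r, hn, hr1, hr2, hq, hr⟩ := h' j k hjk R hR1 hRn
      -- `r ≠ 0`, `q ≠ 0`
      have hn0 : m * m₁ ≠ 0 := mul_ne_zero hm0 hm₁0
      have hr0 : r ≠ 0 := fun h0 => hn0 (by rw [hn, h0, mul_zero])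
      have hq0 : q ≠ 0 := fun h0 => hn0 (by rw [hn, h0, zero_mul])
      -- `n₁ = (r, m₁)`, `r = n₁ r₁`, `m₁ = n₁ n₁'`
      set n₁ : ℕ := Nat.gcd r m₁ with hn₁
      have hn₁pos : 0 < n₁ := Nat.gcd_pos_of_pos_right r (Nat.pos_of_ne_zero hm₁0)
      set r₁ : ℕ := r / n₁ with hr₁
      set n₁' : ℕ := m₁ / n₁ with hn₁'
      have hrr : r = n₁ * r₁ := (Nat.mul_div_cancel' (Nat.gcd_dvd_left r m₁)).symm
      have hmm : m₁ = n₁ * n₁' := (Nat.mul_div_cancel' (Nat.gcd_dvd_right r m₁)).symm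
      have hr₁0 : r₁ ≠ 0 := fun h0 => hr0 (by rw [hrr, h0, mul_zero])
      have hn₁'0 : n₁' ≠ 0 := fun h0 => hm₁0 (by rw [hmm, h0, mul_zero])
      have hcop : Nat.Coprime r₁ n₁' := Nat.coprime_div_gcd_div_gcd hn₁pos
      -- `q r₁ = m n₁'`, so `n₁' ∣ q`; `q = n₁' q₁` and `m = q₁ r₁`
      have hqr : q * r₁ = m * n₁' := by
        apply Nat.eq_of_mul_eq_mul_left hn₁pos
        calc n₁ * (q * r₁) = q * (n₁ * r₁) := by ring
          _ = q * r := by rw [← hrr]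
          _ = m * m₁ := by rw [← hn]
          _ = n₁ * (m * n₁') := by rw [hmm]; ring
      have hn₁'q : n₁' ∣ q := hcop.symm.dvd_of_dvd_mul_right ⟨m, by rw [hqr, mul_comm]⟩
      set q₁ : ℕ := q / n₁' with hq₁
      have hqq : q = n₁' * q₁ := (Nat.mul_div_cancel' hn₁'q).symm
      have hq₁0 : q₁ ≠ 0 := fun h0 => hq0 (by rw [hqq, h0, mul_zero])
      have hmq : m = q₁ * r₁ := by
        apply Nat.eq_of_mul_eq_mul_left (Nat.pos_of_ne_zero hn₁'0)
        calc n₁' * m = m * n₁' := mul_comm _ _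
          _ = q * r₁ := hqr.symm
          _ = n₁' * (q₁ * r₁) := by rw [hqq]; ring
      -- sizes
      have hn₁m₁ : n₁ ≤ m₁ := Nat.le_of_dvd (Nat.pos_of_ne_zero hm₁0) (Nat.gcd_dvd_right r m₁)
      have hn₁'m₁ : n₁' ≤ m₁ := Nat.div_le_self m₁ n₁
      have hn₁R : (0 : ℝ) < n₁ := by exact_mod_cast hn₁pos
      have hrcast : (r : ℝ) = n₁ * r₁ := by exact_mod_cast hrr
      refine ⟨q₁, r₁, hmq, ?_, ?_, ?_, ?_⟩
      · -- `R/(y m₁) ≤ r/m₁ ≤ r/n₁ = r₁`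
        have hm₁pos : (0 : ℝ) < m₁ := by linarith
        calc R / (y * m₁) = R / y / m₁ := by rw [div_div]
          _ ≤ r / m₁ := div_le_div_of_nonneg_right hr1 hm₁pos.le
          _ ≤ r / n₁ := div_le_div_of_nonneg_left (Nat.cast_nonneg r) hn₁R
              (by exact_mod_cast hn₁m₁)
          _ = r₁ := by rw [hrcast, mul_div_cancel_left₀ _ hn₁R.ne']
      · calc (r₁ : ℝ) ≤ r := by exact_mod_cast Nat.div_le_self r n₁
          _ ≤ R := hr2
      · -- `q₁ ∣ q`: `(j, y n₁')`-d.d., hence `(j, y m₁)`-d.d.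
        have h1 : DenselyDivisible (y * n₁') j q₁ :=
          ih j (by omega) hq₁0 hn₁'0 (by rw [mul_comm, ← hqq]; exact hq)
        exact DenselyDivisible.mono
          (one_le_mul_of_one_le_of_one_le hy (by exact_mod_cast Nat.one_le_iff_ne_zero.mpr hn₁'0))
          (mul_le_mul_of_nonneg_left (by exact_mod_cast hn₁'m₁) hy0.le) h1
      · -- `r₁ ∣ r`: `(k, y n₁)`-d.d., hence `(k, y m₁)`-d.d.
        have h1 : DenselyDivisible (y * n₁) k r₁ :=
          ih k (by omega) hr₁0 hn₁pos.ne' (by rw [mul_comm, ← hrr]; exact hr)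
        exact DenselyDivisible.mono
          (one_le_mul_of_one_le_of_one_le hy (by exact_mod_cast hn₁pos))
          (mul_le_mul_of_nonneg_left (by exact_mod_cast hn₁m₁) hy0.le) h1

/-- **Lemma 2.10 (i), second clause**: "if `l` is a multiple of `n`, then `l` is `i`-tuply
`y(l/n)`-densely divisible" whenever `n` is `i`-tuply `y`-densely divisible — here `l = an`,
`y ≥ 1`, `a, n ≥ 1` ("similar and left to the reader" in print; for `a ≤ R ≤ an` factor `n = qr` at
the parameter `R/a` and take `l = q · (ar)`, for `R < a` take `l = (an) · 1`, using induction on `i`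
for the multiples `ar` of `r` and `an` of `n`). [cite: Polymath8a2014, Lemma 2.10 (i)] -/
theorem DenselyDivisible.mul_left {y : ℝ} (hy : 1 ≤ y) :
    ∀ (i : ℕ) {n a : ℕ}, n ≠ 0 → a ≠ 0 → DenselyDivisible y i n →
      DenselyDivisible (y * a) i (a * n) := by
  intro i
  induction i using Nat.strong_induction_on with
  | _ i ih =>
    intro n a hn0 ha0 h
    cases i with
    | zero => exact denselyDivisible_zero _ _
    | succ i =>
      have hy0 : 0 < y := by linarith
      have ha1 : (1 : ℝ) ≤ a := by exact_mod_cast Nat.one_le_iff_ne_zero.mpr ha0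
      have hapos : (0 : ℝ) < a := by linarith
      have hya : 1 ≤ y * a := one_le_mul_of_one_le_of_one_le hy ha1
      have hyya : y ≤ y * a := le_mul_of_one_le_right hy0.le ha1
      refine DenselyDivisible.succ_of_le_self hya
        (fun j hj => ih j (by omega) hn0 ha0 (h.anti (by omega))) ?_
      intro j k hjk R hR1 hRl
      have h' := (denselyDivisible_succ_iff y i n).mp h
      rcases lt_or_ge R a with hRa | hRa
      · -- `R < a`: `l = (an) · 1`
        refine ⟨a * n, 1, (mul_one _).symm, ?_, by exact_mod_cast hR1,
          ih j (by omega) hn0 ha0 (h.anti (by omega)), denselyDivisible_one _ k⟩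
        rw [Nat.cast_one, div_le_one (by positivity)]
        calc R ≤ a := hRa.le
          _ = 1 * a := (one_mul _).symm
          _ ≤ y * a := mul_le_mul_of_nonneg_right hy hapos.le
      · -- `a ≤ R ≤ an`: factor `n` at `R/a`
        have hR'1 : 1 ≤ R / a := by rwa [le_div_iff₀ hapos, one_mul]
        have hR'2 : R / a ≤ y * n := by
          rw [div_le_iff₀ hapos]
          calc R ≤ (a * n : ℕ) := hRl
            _ = 1 * (n * a) := by push_cast; ring
            _ ≤ y * (n * a) := mul_le_mul_of_nonneg_right hy (by positivity)
            _ = y * n * a := by ring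
        obtain ⟨q, r, hnqr, hr1, hr2, hq, hr⟩ := h' j k hjk (R / a) hR'1 hR'2
        have hr0 : r ≠ 0 := fun h0 => hn0 (by rw [hnqr, h0, mul_zero])
        refine ⟨q, a * r, by rw [hnqr]; ring, ?_, ?_, DenselyDivisible.mono hy hyya hq,
          ih k (by omega) hr0 ha0 hr⟩
        · -- `R/(ya) ≤ R/y ≤ a r`
          rw [div_div, div_le_iff₀ (by positivity : (0 : ℝ) < a * y)] at hr1
          calc R / (y * a) ≤ R / y := div_le_div_of_nonneg_left (by linarith) hy0 hyya
            _ ≤ (a * r : ℕ) := by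
                rw [div_le_iff₀ hy0]; push_cast
                calc R ≤ r * (a * y) := hr1
                  _ = a * r * y := by ring
        · rw [le_div_iff₀ hapos] at hr2
          push_cast
          calc (a : ℝ) * r = r * a := mul_comm _ _
            _ ≤ R := hr2

end Literature.NumberTheory.Sieve
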